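import Summits.BirchSwinnertonDyer.BirchSwinnertonDyer.Theorems.SmallImageMuTransferMuTransferX9TopGenerator
import Literature.NumberTheory.EllipticCurves.SerreOpenImageDeterminantProofs
import Literature.NumberTheory.GaloisRepresentations.GL2F3Lift
import HarnessLib

/-!
# `ℚ(E[3]) ∩ ℚ_∞ = ℚ` for EVERY `E/ℚ` with `E[3]` irreducible — the K6 μ-core inputs (F2)/(F8) at `p = 3`
# WITHOUT the binder `ρ̄_{E,3}` not onto (route `KatoDescentPotSupersingular`, U₀ parent item
# stmt-BirchSwinnertonDyer-19197 `WildUpperDefectRankZero` / U₀-ns node 19189; route-free helper)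

Seat `bsd-potss-k9-c4` g14 (prover; cell `bsd-potss`); `--supports stmt-BirchSwinnertonDyer-19197 --as helper`;
closes nothing.  HONEST FRAMING (cell): BSD is not proved by any of this; nothing is booked; no item closes;
THEOREMS ONLY (no definition, no named fact, no `sorry`).

## Why

On the IRREDUCIBLE NON-SURJECTIVE-TOWER rows of the wild class O6 at `p = 3` (node `WildUpperNonsurjTower`,
item 19189, the only irreducible leaf of the U₀ parent 19197) Kato's (12.5.2) fails.  Since rkm g15
(`Theorems/KatoDescentPotSupersingularSmallImageEulerSystemDivisibilityIrreducible.lean`) the rows with `ρ̄_{E,3}`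
NOT onto (normaliser-of-Cartan images) carry a second, FINE road: the K6 kernel `μ`-core
(`Rank1Residual.CoreAssembly.coreOdd_anyReduction_holds`, cells `bsd-smallim` / `b2b-bsdres` / `bsd-stepL`) plus
Kato Thm. 13.4 (2) give `char_Λ(𝐇¹_Γ/Λs) ⊆ char_Λ X₀` from ONE `p`-indivisible Euler-system class.  The `μ`-core
carries the binder `¬ W.HasSurjectiveModNGaloisRep 3`, and it enters its proof through exactly two image facts:

* (R1) a Galois element acting on `E[3]` by a scalar `≠ 1` (`exists_galoisRepTorsion_eq_smul_of_not_surjective_three`,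
  the scalar `−1`) — since proved for EVERY irreducible `E[3]`, onto or not, by the `bsd-stepL` / `b2b-bsdres`
  theorem `GaloisImage.exists_smul_eq_neg_three_of_irr` (`Rank1Residual/GaloisImage/IrreducibleModThreeCentralInvolution.lean`);
* (R2) `3 ∤ #ρ̄_{E,3}(Γ_ℚ)` (`not_dvd_card_range_galoisRepTorsion_of_irreducible_of_not_surjective`, Serre Prop. 15),
  used ONLY to derive MU-TRANSFER-PROOF (F2)/(F8) — «`ℚ(E[3]) ∩ ℚ_∞ = ℚ`»: `κ(ker ρ̄) = ℤ₃`, the joint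
  surjection `(ρ̄, κ) : Γ_ℚ ↠ Ḡ × ℤ₃`, `Γ_ℚ = ker ρ̄ · Γ_{ℚ_n}`, and a topological generator of `κ` fixing
  `E[3]` (`Theorems/SmallImageMuTransferMuTransferX9TopGenerator.lean`).  (R2) is FALSE on the remaining
  U₀-ns rows — Elkies' 9-deficient rows, `ρ̄_{E,3}` onto `GL₂(𝔽₃)` of order `48` — but (F2)/(F8) are TRUE there.

THIS FILE proves (F2)/(F8) at `p = 3` for EVERY `E/ℚ` with `E[3]` irreducible, surjective or not:

* §1 `ZpImage.…` — group theory generalising K6's `ZpImage.map_eq_top_of_coprime_index`: a finite-index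
  subgroup `H ≤ G` maps ONTO `ℤ_p` under any surjection `f : G ↠ ℤ_p` as soon as NO NORMAL subgroup
  `N ⊇ H` of `G` has index `p` (a proper finite-index subgroup of `ℤ_p` lies in `pℤ_p`, whose preimage is
  normal of index `p`); with the element / joint-surjectivity / lattice corollaries.
* §2 `GL2F3.not_normal_index_three` — a group isomorphic to `GL₂(𝔽₃)` has NO normal subgroup of index `3`:
  such an `N` has order `16` (`#GL₂(𝔽₃) = 48`, tree `GL2F3Lift.card_GL_fin_two_zmod_three`) and contains every involution,
  in particular `a = (1 1; 0 −1)` and `b = (1 −1; 0 −1)`, whose product `(1 1; 0 1)` has order `3 ∤ 16`.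
* §3 **`forall_normal_index_ne_three_of_irr`** — for `E/ℚ` with `E[3]` irreducible, no normal subgroup of
  `Γ_ℚ` containing `ker ρ̄_{E,3}` has index `3` (onto: §2 in Serre's frame `exists_frame_galoisRepTorsion_rat`;
  not onto: `3 ∤ #Ḡ`, K6).  Hence, for EVERY `ℤ₃`-extension `κ` of `ℚ`:
  **`map_ker_galoisRepTorsion_eq_top_three_of_irr`** (`κ(Gal(ℚ̄/ℚ(E[3]))) = ℤ₃`, i.e. `ℚ(E[3]) ∩ ℚ_∞ = ℚ`),
  **`exists_galoisRepTorsion_eq_and_eq_three_of_irr`** (`(ρ̄_{E,3}, κ) : Γ_ℚ ↠ Ḡ × ℤ₃`),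
  **`ker_galoisRepTorsion_sup_layerSubgroup_eq_top_three_of_irr`** / **`…_sup_kerSubgroup_…`**
  (`Γ_ℚ = ker ρ̄ · Γ_{ℚ_n}` at every layer), **`exists_isTopGenerator_forall_smul_eq_three_of_irr`**
  (a topological generator `γ₀` of `κ` fixing `E[3]` pointwise — the hypotheses of
  `LevelE.modPTwist_stable_addSubgroup_eq_tPow`, p432130, verbatim).

So both named uses (R1)/(R2) of `¬Surj` in the K6 `μ`-core have `Irr`-only replacements at `p = 3`; re-running
the core under `Irr W 3` alone would put the 9-deficient sub-rows of `WildUpperNonsurjTower` (and the big-image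
rows) on the fine road of rkm g15–g16 as well.  That re-run is NOT done here (memo FINDING-19197-…-k9c4g14.md).

References: [Serre1972] J.-P. Serre, Invent. Math. 15 (1972) §2.4 Prop. 15, §2.5–2.6 (subgroups of `GL₂(𝔽₃)`);
[Washington1997] L. C. Washington, GTM 83, §13.1–13.2; [MazurRubin2004] §5.3; tree: K6's
`Theorems/SmallImageMuTransferMuTransferX9TopGenerator.lean` (whose §§ this file mirrors), HOME
pub/bsd-smallim/koly/MU-TRANSFER-PROOF.md (F2)/(F8).
-/

-- the summit and its single problem are both named `BirchSwinnertonDyer` (registry layout D-0017)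
set_option linter.dupNamespace false
set_option autoImplicit false

noncomputable section

open Field WeierstrassCurve Literature.NumberTheory.EllipticCurves

namespace Summit.BirchSwinnertonDyer.BirchSwinnertonDyer.Theorems.IrrThreeDisjoint

/-! ## §1 Group theory: a finite-index subgroup with no normal index-`p` oversubgroup maps ONTO `ℤ_p` -/

namespace ZpImage

universe v w

variable {G : Type v} [Group G] {p : ℕ} [Fact p.Prime]

/-- A finite-index subgroup of `ℤ_p` (written multiplicatively) containing a UNIT is everything: with
`n = [ℤ_p : A] = p^e·m`, `p ∤ m`, every `p^e z = n·(m⁻¹ z)` lies in `A`, and `ℤ·u + p^e ℤ_p = ℤ_p` for a unit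
`u` (`PadicInt.appr`). [cite: Washington1997, §13.1] -/
theorem eq_top_of_isUnit_mem (A : Subgroup (Multiplicative ℤ_[p])) (hA : A.index ≠ 0) {u : ℤ_[p]}
    (hu : IsUnit u) (huA : Multiplicative.ofAdd u ∈ A) : A = ⊤ := by
  have hp : p.Prime := Fact.out
  obtain ⟨e, m, hm, hnm⟩ := Nat.exists_eq_pow_mul_and_not_dvd hA p hp.one_lt.ne'
  -- `p^e • z ∈ A` for every `z`
  have hmu : IsUnit (m : ℤ_[p]) :=
    PadicInt.isUnit_iff.mpr (PadicInt.norm_natCast_eq_one_iff.mpr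
      ((Nat.Prime.coprime_iff_not_dvd hp).mpr hm))
  obtain ⟨mu, hmu'⟩ := hmu
  have hpe : ∀ z : ℤ_[p], Multiplicative.ofAdd ((p : ℤ_[p]) ^ e * z) ∈ A := by
    intro z
    have hz : (p : ℤ_[p]) ^ e * z = (A.index : ℤ_[p]) * ((↑mu⁻¹ : ℤ_[p]) * z) := by
      rw [hnm, Nat.cast_mul, Nat.cast_pow, ← hmu', mul_assoc, ← mul_assoc (mu : ℤ_[p]),
        Units.mul_inv, one_mul]
    rw [hz, ← nsmul_eq_mul, ofAdd_nsmul]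
    exact A.pow_index_mem _
  -- `u` a unit: every `z` is `k • u + p^e (t u)` with `k ∈ ℕ`
  obtain ⟨u', hu'⟩ := hu
  rw [Subgroup.eq_top_iff']
  intro x
  set z : ℤ_[p] := Multiplicative.toAdd x with hz
  set w : ℤ_[p] := z * (↑u'⁻¹ : ℤ_[p]) with hw
  obtain ⟨t, ht⟩ := Ideal.mem_span_singleton.mp (PadicInt.appr_spec e w)
  have hzdec : z = (PadicInt.appr w e : ℤ_[p]) * u + (p : ℤ_[p]) ^ e * (t * u) := by
    have : z = w * u := by rw [hw, ← hu', mul_assoc, Units.inv_mul, mul_one]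
    rw [this, ← mul_assoc, ← add_mul, ← ht, add_sub_cancel]
  have hx : x = Multiplicative.ofAdd u ^ (PadicInt.appr w e) *
      Multiplicative.ofAdd ((p : ℤ_[p]) ^ e * (t * u)) := by
    rw [← ofAdd_nsmul, ← ofAdd_add, nsmul_eq_mul, ← hzdec, hz, ofAdd_toAdd]
  rw [hx]
  exact A.mul_mem (A.pow_mem huA _) (hpe _)

/-- A PROPER finite-index subgroup of `ℤ_p` lies in `p ℤ_p` (every element of it is a non-unit, by
`eq_top_of_isUnit_mem`). [cite: Washington1997, §13.1] -/
theorem le_toSubgroup_span_of_ne_top (A : Subgroup (Multiplicative ℤ_[p])) (hA : A.index ≠ 0)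
    (hAt : A ≠ ⊤) :
    A ≤ AddSubgroup.toSubgroup (Ideal.span {(p : ℤ_[p]) ^ 1}).toAddSubgroup := by
  intro x hx
  rw [Multiplicative.mem_toSubgroup, Submodule.mem_toAddSubgroup, Ideal.mem_span_singleton, pow_one,
    ← PadicInt.norm_lt_one_iff_dvd]
  by_contra hlt
  have h1 : ‖Multiplicative.toAdd x‖ = 1 := le_antisymm (PadicInt.norm_le_one _) (not_lt.mp hlt)
  exact hAt (eq_top_of_isUnit_mem A hA (PadicInt.isUnit_iff.mpr h1) (by simpa using hx))

/-- The subgroup `p ℤ_p` of `ℤ_p` has index `p`. [cite: Washington1997, §13.1] -/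
theorem index_toSubgroup_span_one :
    (AddSubgroup.toSubgroup (Ideal.span {(p : ℤ_[p]) ^ 1}).toAddSubgroup).index = p := by
  rw [ZpExtension.index_toSubgroup_span_pow (p := p) 1, pow_one]

/-- **A finite-index subgroup `H ≤ G` maps ONTO `ℤ_p`** under any surjection `f : G ↠ ℤ_p` as soon as
no NORMAL subgroup `N ⊇ H` of `G` has index `p`: otherwise `f(H) ⊆ p ℤ_p` (`le_toSubgroup_span_of_ne_top`)
and `N = f⁻¹(p ℤ_p)` is one.  (K6's `ZpImage.map_eq_top_of_coprime_index` is the case `p ∤ [G : H]`.)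
[cite: Washington1997, §13.1] -/
theorem map_eq_top_of_forall_normal_index_ne (f : G →* Multiplicative ℤ_[p])
    (hf : Function.Surjective f) (H : Subgroup G) (hHi : H.index ≠ 0)
    (hH : ∀ N : Subgroup G, N.Normal → H ≤ N → N.index ≠ p) : H.map f = ⊤ := by
  by_contra hne
  have hAi : (H.map f).index ≠ 0 := fun h0 ↦ hHi (Nat.eq_zero_of_zero_dvd (h0 ▸ H.index_map_dvd hf))
  have hle := le_toSubgroup_span_of_ne_top (H.map f) hAi hne
  set P : Subgroup (Multiplicative ℤ_[p]) :=
    AddSubgroup.toSubgroup (Ideal.span {(p : ℤ_[p]) ^ 1}).toAddSubgroup with hP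
  haveI : P.Normal := inferInstance
  refine hH (P.comap f) inferInstance (fun h hh ↦ ?_) ?_
  · exact Subgroup.mem_comap.mpr (hle (Subgroup.mem_map_of_mem f hh))
  · rw [Subgroup.index_comap_of_surjective _ hf, hP, index_toSubgroup_span_one]

/-- Element form: every `y ∈ ℤ_p` is `f h` for some `h ∈ H`. [cite: Washington1997, §13.1] -/
theorem exists_mem_and_eq (f : G →* Multiplicative ℤ_[p]) (hf : Function.Surjective f)
    (H : Subgroup G) (hHi : H.index ≠ 0) (hH : ∀ N : Subgroup G, N.Normal → H ≤ N → N.index ≠ p)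
    (y : Multiplicative ℤ_[p]) : ∃ h ∈ H, f h = y := by
  rw [← Subgroup.mem_map, map_eq_top_of_forall_normal_index_ne f hf H hHi hH]
  exact Subgroup.mem_top y

/-- **Joint surjectivity `(g, f) : G ↠ g(G) × ℤ_p`** when `ker g` has finite index, no normal subgroup of
`G` containing `ker g` has index `p`, and `f : G ↠ ℤ_p`. [cite: Washington1997, §13.1] -/
theorem exists_ker_eq_and_eq {M : Type w} [Group M] (g : G →* M)
    (f : G →* Multiplicative ℤ_[p]) (hf : Function.Surjective f) (hgi : g.ker.index ≠ 0)
    (hg : ∀ N : Subgroup G, N.Normal → g.ker ≤ N → N.index ≠ p)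
    (τ : G) (y : Multiplicative ℤ_[p]) : ∃ σ : G, g σ = g τ ∧ f σ = y := by
  obtain ⟨h, hh, hfh⟩ := exists_mem_and_eq f hf g.ker hgi hg ((f τ)⁻¹ * y)
  refine ⟨τ * h, ?_, ?_⟩
  · rw [map_mul, MonoidHom.mem_ker.mp hh, mul_one]
  · rw [map_mul, hfh, mul_inv_cancel_left]

/-- Lattice form: `ker g ⊔ K = ⊤` for every subgroup `K ⊇ ker f`, under the same hypotheses.
[cite: Washington1997, §13.1] -/
theorem ker_sup_eq_top_of_ker_le {M : Type w} [Group M] (g : G →* M)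
    (f : G →* Multiplicative ℤ_[p]) (hf : Function.Surjective f) (hgi : g.ker.index ≠ 0)
    (hg : ∀ N : Subgroup G, N.Normal → g.ker ≤ N → N.index ≠ p)
    (K : Subgroup G) (hK : f.ker ≤ K) : g.ker ⊔ K = ⊤ := by
  rw [Subgroup.eq_top_iff']
  intro x
  obtain ⟨h, hh, hfh⟩ := exists_mem_and_eq f hf g.ker hgi hg (f x)
  have hx : x = h * (h⁻¹ * x) := by rw [mul_inv_cancel_left]
  rw [hx]
  refine Subgroup.mul_mem_sup hh (hK ?_)
  rw [MonoidHom.mem_ker, map_mul, map_inv, hfh, inv_mul_cancel]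

end ZpImage

/-! ## §2 `GL₂(𝔽₃)` has no normal subgroup of index `3` -/

namespace GL2F3

/-- Two involutions of `GL₂(𝔽₃)` whose product has order `3`: `a = (1 1; 0 −1)`, `b = (1 −1; 0 −1)`,
`ab = (1 1; 0 1)`. [cite: Serre1972, §2.5] -/
theorem exists_involutions_mul_order_three :
    ∃ a b : GL (Fin 2) (ZMod 3), a ^ 2 = 1 ∧ b ^ 2 = 1 ∧ (a * b) ^ 3 = 1 ∧ a * b ≠ 1 := by
  refine ⟨⟨!![1, 1; 0, -1], !![1, 1; 0, -1], ?_, ?_⟩, ⟨!![1, -1; 0, -1], !![1, -1; 0, -1], ?_, ?_⟩,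
    ?_, ?_, ?_, ?_⟩
  · simp [Matrix.one_fin_two]
  · simp [Matrix.one_fin_two]
  · simp [Matrix.one_fin_two]
  · simp [Matrix.one_fin_two]
  · ext i j
    fin_cases i <;> fin_cases j <;> simp [pow_two]
  · ext i j
    fin_cases i <;> fin_cases j <;> simp [pow_two]
  · ext i j
    fin_cases i <;> fin_cases j <;> simp [pow_succ]
    decide
  · intro h
    have h01 := congrArg (fun g : GL (Fin 2) (ZMod 3) ↦ (g : Matrix (Fin 2) (Fin 2) (ZMod 3)) 0 1) h
    simp at h01
    exact absurd h01 (by decide)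

/-- **A group isomorphic to `GL₂(𝔽₃)` has no NORMAL subgroup of index `3`**: such an `N` has order `16`
and contains every element of order dividing `2` (its image in the quotient of order `3` is killed by `2` and
by `3`), in particular two involutions whose product has order `3 ∤ 16`. [cite: Serre1972, §2.5–2.6] -/
theorem not_normal_index_three {A : Type*} [Group A] (Φ : A ≃* GL (Fin 2) (ZMod 3))
    (N : Subgroup A) [hN : N.Normal] (h3 : N.index = 3) : False := by
  have hcardA : Nat.card A = 48 := by
    rw [Nat.card_congr Φ.toEquiv, Literature.NumberTheory.GaloisRepresentations.GL2F3Lift.card_GL_fin_two_zmod_three]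
  haveI : Finite A := Nat.finite_of_card_ne_zero (by rw [hcardA]; norm_num)
  have hN16 : Nat.card N = 16 := by
    have h := N.card_mul_index
    rw [h3, hcardA] at h
    omega
  -- every `x` with `x² = 1` lies in `N`
  have key : ∀ x : A, x ^ 2 = 1 → x ∈ N := by
    intro x hx
    rw [← QuotientGroup.eq_one_iff]
    have hq3 : Nat.card (A ⧸ N) = 3 := by rw [← Subgroup.index_eq_card, h3]
    have h2 : (QuotientGroup.mk' N x) ^ 2 = 1 := by rw [← map_pow, hx, map_one]
    have h3' : (QuotientGroup.mk' N x) ^ 3 = 1 := by rw [← hq3]; exact pow_card_eq_one'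
    have : QuotientGroup.mk' N x = (QuotientGroup.mk' N x) ^ 3 * ((QuotientGroup.mk' N x) ^ 2)⁻¹ := by
      group
    rw [QuotientGroup.mk'_apply] at this h2 h3'
    rw [this, h2, h3', inv_one, mul_one]
  obtain ⟨a, b, ha, hb, hab3, hab1⟩ := exists_involutions_mul_order_three
  have ha' : Φ.symm a ^ 2 = 1 := by rw [← map_pow, ha, map_one]
  have hb' : Φ.symm b ^ 2 = 1 := by rw [← map_pow, hb, map_one]
  have hu : Φ.symm a * Φ.symm b ∈ N := N.mul_mem (key _ ha') (key _ hb')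
  have hu3 : (Φ.symm a * Φ.symm b) ^ 3 = 1 := by rw [← map_mul, ← map_pow, hab3, map_one]
  have hu1 : Φ.symm a * Φ.symm b ≠ 1 := by
    rw [← map_mul, Ne, MulEquiv.map_eq_one_iff]
    exact hab1
  haveI : Fact (Nat.Prime 3) := ⟨Nat.prime_three⟩
  have hord : orderOf (⟨Φ.symm a * Φ.symm b, hu⟩ : N) = 3 := by
    rw [Subgroup.orderOf_mk]
    exact orderOf_eq_prime hu3 hu1
  have hdvd : 3 ∣ Nat.card N := hord ▸ orderOf_dvd_natCard _
  rw [hN16] at hdvd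
  omega

end GL2F3

/-! ## §3 Over `ℚ` at `p = 3`: `E[3]` irreducible ⟹ (F2)/(F8) for every `ℤ₃`-extension -/

section Rat

variable (W : WeierstrassCurve ℚ) [W.IsElliptic] (κ : ZpExtension ℚ 3)

/-- `Aut(E[3])` is finite; hence `[Γ_ℚ : ker ρ̄_{E,3}] = #ρ̄_{E,3}(Γ_ℚ) ≠ 0`. [cite: Serre1972, §2.5] -/
theorem index_ker_galoisRepTorsion_three_ne_zero :
    haveI : Fact (Nat.Prime 3) := ⟨Nat.prime_three⟩
    (galoisRepTorsion W (3 : ℕ)).ker.index ≠ 0 := by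
  haveI : Fact (Nat.Prime 3) := ⟨Nat.prime_three⟩
  obtain ⟨-, Φ, -⟩ := exists_frame_galoisRepTorsion_rat W 3
  haveI : Finite (Multiplicative (AddAut (geomTorsion W (3 : ℕ)))) := Finite.of_equiv _ Φ.toEquiv.symm
  rw [Subgroup.index_ker]
  exact Nat.card_pos.ne'

/-- **`E[3]` irreducible ⟹ no normal subgroup of `Γ_ℚ` containing `ker ρ̄_{E,3} = Gal(ℚ̄/ℚ(E[3]))` has
index `3`** (i.e. `ℚ(E[3])` contains no cyclic cubic Galois extension of `ℚ`; the image `Ḡ ≤ GL₂(𝔽₃)` has no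
`C₃` quotient): if `ρ̄_{E,3}` is onto, `Ḡ ≅ GL₂(𝔽₃)` and §2 applies to the image of `N` (normal, index `3`);
if not, `3 ∤ #Ḡ` (Serre Prop. 15, K6's `not_dvd_card_range_galoisRepTorsion_of_irreducible_of_not_surjective`)
while `[Γ_ℚ : N] ∣ [Γ_ℚ : ker ρ̄] = #Ḡ`. [cite: Serre1972, §2.4 Prop. 15, §2.5–2.6] -/
theorem forall_normal_index_ne_three_of_irr (hirr : W.HasIrreducibleModPGaloisRep 3) :
    haveI : Fact (Nat.Prime 3) := ⟨Nat.prime_three⟩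
    ∀ N : Subgroup (absoluteGaloisGroup ℚ), N.Normal → (galoisRepTorsion W (3 : ℕ)).ker ≤ N →
      N.index ≠ 3 := by
  haveI : Fact (Nat.Prime 3) := ⟨Nat.prime_three⟩
  intro N hN hle h3
  by_cases hs : W.HasSurjectiveModNGaloisRep (3 : ℕ)
  · -- onto: transport `N` to `Aut(E[3]) ≅ GL₂(𝔽₃)`
    obtain ⟨-, Φ, -⟩ := exists_frame_galoisRepTorsion_rat W 3
    have hs' : Function.Surjective (galoisRepTorsion W (3 : ℕ)) := hs
    haveI : (N.map (galoisRepTorsion W (3 : ℕ))).Normal := hN.map _ hs'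
    refine GL2F3.not_normal_index_three Φ (N.map (galoisRepTorsion W (3 : ℕ))) ?_
    rw [Subgroup.index_map_eq _ hs' hle, h3]
  · -- not onto: `3 ∤ #Ḡ = [Γ_ℚ : ker ρ̄]`, and `[Γ_ℚ : N] ∣ [Γ_ℚ : ker ρ̄]`
    have h3G := Rank1Residual.not_dvd_card_range_galoisRepTorsion_of_irreducible_of_not_surjective
      W 3 hirr hs
    have hdvd : N.index ∣ (galoisRepTorsion W (3 : ℕ)).ker.index := Subgroup.index_dvd_of_le hle
    rw [h3, Subgroup.index_ker] at hdvd
    exact h3G hdvd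

/-- **(F2) `κ(Gal(ℚ̄/ℚ(E[3]))) = ℤ₃` — `ℚ(E[3]) ∩ ℚ_∞ = ℚ` — for EVERY `E/ℚ` with `E[3]` irreducible
(surjective `ρ̄_{E,3}` included) and every `ℤ₃`-extension `κ` of `ℚ`.** [cite: Serre1972, §2.4 Prop. 15, §2.5]
[cite: Washington1997, §13.1] -/
theorem map_ker_galoisRepTorsion_eq_top_three_of_irr (hirr : W.HasIrreducibleModPGaloisRep 3) :
    haveI : Fact (Nat.Prime 3) := ⟨Nat.prime_three⟩
    (galoisRepTorsion W (3 : ℕ)).ker.map κ.toContinuousMonoidHom.toMonoidHom = ⊤ :=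
  ZpImage.map_eq_top_of_forall_normal_index_ne _ κ.surjective _
    (index_ker_galoisRepTorsion_three_ne_zero W) (forall_normal_index_ne_three_of_irr W hirr)

/-- **(F2)/(F8) `(ρ̄_{E,3}, κ) : Γ_ℚ ↠ Ḡ × ℤ₃`** for every `E/ℚ` with `E[3]` irreducible and every
`ℤ₃`-extension `κ`: for every `τ ∈ Γ_ℚ` and `y ∈ ℤ₃` some `σ` acts on `E[3]` as `τ` and has `κ σ = y`.
[cite: Serre1972, §2.4 Prop. 15, §2.5] [cite: Washington1997, §13.1] -/
theorem exists_galoisRepTorsion_eq_and_eq_three_of_irr (hirr : W.HasIrreducibleModPGaloisRep 3)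
    (τ : absoluteGaloisGroup ℚ) (y : Multiplicative ℤ_[3]) :
    haveI : Fact (Nat.Prime 3) := ⟨Nat.prime_three⟩
    ∃ σ : absoluteGaloisGroup ℚ,
      galoisRepTorsion W (3 : ℕ) σ = galoisRepTorsion W (3 : ℕ) τ ∧ κ σ = y := by
  haveI : Fact (Nat.Prime 3) := ⟨Nat.prime_three⟩
  exact ZpImage.exists_ker_eq_and_eq (galoisRepTorsion W (3 : ℕ)) κ.toContinuousMonoidHom.toMonoidHom
    κ.surjective (index_ker_galoisRepTorsion_three_ne_zero W) (forall_normal_index_ne_three_of_irr W hirr)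
    τ y

/-- **(F8) "`G ↠ Ḡ × Γ_e`" at every finite layer**: `Γ_ℚ = ker ρ̄_{E,3} · Gal(ℚ̄/ℚ_n)` for every `E/ℚ`
with `E[3]` irreducible, every `ℤ₃`-extension `κ` and every `n`. [cite: Serre1972, §2.4 Prop. 15, §2.5]
[cite: Washington1997, §13.1] -/
theorem ker_galoisRepTorsion_sup_layerSubgroup_eq_top_three_of_irr
    (hirr : W.HasIrreducibleModPGaloisRep 3) (n : ℕ) :
    haveI : Fact (Nat.Prime 3) := ⟨Nat.prime_three⟩
    (galoisRepTorsion W (3 : ℕ)).ker ⊔ κ.layerSubgroup n = ⊤ := by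
  haveI : Fact (Nat.Prime 3) := ⟨Nat.prime_three⟩
  exact ZpImage.ker_sup_eq_top_of_ker_le (galoisRepTorsion W (3 : ℕ))
    κ.toContinuousMonoidHom.toMonoidHom κ.surjective (index_ker_galoisRepTorsion_three_ne_zero W)
    (forall_normal_index_ne_three_of_irr W hirr) _ (κ.kerSubgroup_le_layerSubgroup n)

/-- **"`G ↠ Ḡ × Γ`"**: `Γ_ℚ = ker ρ̄_{E,3} · Gal(ℚ̄/ℚ_∞)` for every `E/ℚ` with `E[3]` irreducible and
every `ℤ₃`-extension `κ`. [cite: Serre1972, §2.4 Prop. 15, §2.5] [cite: Washington1997, §13.1] -/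
theorem ker_galoisRepTorsion_sup_kerSubgroup_eq_top_three_of_irr
    (hirr : W.HasIrreducibleModPGaloisRep 3) :
    haveI : Fact (Nat.Prime 3) := ⟨Nat.prime_three⟩
    (galoisRepTorsion W (3 : ℕ)).ker ⊔ κ.kerSubgroup = ⊤ := by
  haveI : Fact (Nat.Prime 3) := ⟨Nat.prime_three⟩
  exact ZpImage.ker_sup_eq_top_of_ker_le (galoisRepTorsion W (3 : ℕ))
    κ.toContinuousMonoidHom.toMonoidHom κ.surjective (index_ker_galoisRepTorsion_three_ne_zero W)
    (forall_normal_index_ne_three_of_irr W hirr) _ le_rfl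

/-- **A topological generator of `κ` in `ker ρ̄_{E,3}`** for every `E/ℚ` with `E[3]` irreducible and
every `ℤ₃`-extension `κ`. [cite: Serre1972, §2.4 Prop. 15, §2.5] [cite: Washington1997, §13.1–§13.2] -/
theorem exists_isTopGenerator_galoisRepTorsion_eq_one_three_of_irr
    (hirr : W.HasIrreducibleModPGaloisRep 3) :
    haveI : Fact (Nat.Prime 3) := ⟨Nat.prime_three⟩
    ∃ γ₀ : absoluteGaloisGroup ℚ, κ.IsTopGenerator γ₀ ∧ galoisRepTorsion W (3 : ℕ) γ₀ = 1 := by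
  haveI : Fact (Nat.Prime 3) := ⟨Nat.prime_three⟩
  obtain ⟨σ, h1, h2⟩ :=
    exists_galoisRepTorsion_eq_and_eq_three_of_irr W κ hirr 1 (Multiplicative.ofAdd 1)
  exact ⟨σ, h2, by rw [h1, map_one]⟩

/-- **(F8) a topological generator `γ₀` of `κ` FIXING `E[3]` pointwise** — the hypotheses
`(hγ₀ : κ.IsTopGenerator γ₀) (hγ₀E : ∀ P : E[3], γ₀ • P = P)` of `LevelE.modPTwist_stable_addSubgroup_eq_tPow`
(p432130) — for EVERY `E/ℚ` with `E[3]` irreducible (onto `GL₂(𝔽₃)` or not) and every `ℤ₃`-extension `κ`.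
[cite: Serre1972, §2.4 Prop. 15, §2.5] [cite: Washington1997, §13.1–§13.2] -/
theorem exists_isTopGenerator_forall_smul_eq_three_of_irr (hirr : W.HasIrreducibleModPGaloisRep 3) :
    ∃ γ₀ : absoluteGaloisGroup ℚ, κ.IsTopGenerator γ₀ ∧
      ∀ P : geomTorsion W (3 : ℕ), γ₀ • P = P := by
  haveI : Fact (Nat.Prime 3) := ⟨Nat.prime_three⟩
  obtain ⟨γ₀, hγ₀, h1⟩ := exists_isTopGenerator_galoisRepTorsion_eq_one_three_of_irr W κ hirr
  refine ⟨γ₀, hγ₀, fun P ↦ ?_⟩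
  rw [← galoisRepTorsion_apply, h1]
  rfl

end Rat

end Summit.BirchSwinnertonDyer.BirchSwinnertonDyer.Theorems.IrrThreeDisjoint
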